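import Mathlib
import Summits.QuantumAdvantage.AdviceFreeQNC0.WindowLocalization
import Summits.QuantumAdvantage.AdviceFreeQNC0.CleanGapStrategies
import Summits.QuantumAdvantage.AdviceFreeQNC0.CrossTeamEmbedding
import Summits.QuantumAdvantage.QuantumAdvantage.Theorems.RegisterRotationA
import Summits.QuantumAdvantage.QuantumAdvantage.Theorems.RigidityLawsA
import Summits.QuantumAdvantage.QuantumAdvantage.Theorems.RigidityLawsB

set_option linter.dupNamespace false

/-!
# AbsorptionDial (A) — window absorption in the u-walk game (cell decomp-qadv, lens 4, g14; node `AbsorptionDial`)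

Prop-definition-free theorems over the tree's `HasDegF` / `ringWinU` / `WindowLocalization.mixedWinU`
(supports of item stmt-QuantumAdvantage-26994 ≡ 26767 on its LOSS-COUNT axis):

* `hasDegF_parity` — the parity of a finset-indexed family of degree-`d` Boolean functions has `𝔽_p`-degree `≤ |s|·d`;
* `absorb`, `ringWinU_absorb`, `hasDegF_absorb` — **the absorbing pair**: an EVEN eliminator triple `P` (consulted at
  `|w| mod 3`, `P₀ ⊕ P₁ ⊕ P₂ ≡ 0`) is realised by TWO walk slots of the plain game, at degree `≤ 2·deg P + 1`;
* `mixedWinU_eq_ringWinU_absorb` — hence the tree's MIXED window game is the PLAIN game (`y ⊕ absorb c P`);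
* `windowAbsorb`, `ringWinU_glue3_eq_windowAbsorb`, `hasDegF_windowAbsorb` — on the fibre `a ++ w ++ b` a degree-`d`
  strategy on `k+ℓ+q` bits is a degree-`≤ d + 2(k+q)d + 1` plain strategy on the `ℓ` window bits, with the same outcomes;
* `card_losers_ge_of_windows`, `exists_perfect_fibre`, `perfect_of_few_losses` — **the lens law**: fewer than `2^(k+q)`
  losses ⟹ a PERFECT plain strategy on a window (pigeonhole over fibres + absorption).

0 sorry; axioms standard; no `instance`, no `notation`, no `native_decide`.
-/

open Finset
open Literature.Computability.MetaComplexity Literature.Computability.MetaComplexity.Smolensky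
open Summit.QuantumAdvantage.AdviceFreeQNC0

namespace Summit.QuantumAdvantage.QuantumAdvantage.Theorems.AbsorptionDial

/-! ## §2 Degree bookkeeping: the parity of a family of degree-`d` Boolean functions -/

variable {p : ℕ} [Fact p.Prime]

/-- parity flips when one summand is added. -/
private theorem decide_succ_odd (k : ℕ) : decide ((k + 1) % 2 = 1) = !decide (k % 2 = 1) := by
  rcases Nat.mod_two_eq_zero_or_one k with h | h <;> simp [Nat.add_mod, h]

/-- **parity of a family**: the parity bit of `#{i ∈ s : f_i(x)}` has `𝔽_p`-degree `≤ |s|·d` when every `f_i` has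
degree `≤ d` (iterated `RigidityLaws.hasDegF_xor`: `f ⊕ g = f + g − 2fg`, degrees ADD — the cost that is free at `p = 2`). -/
theorem hasDegF_parity {n d : ℕ} {ι : Type*} [DecidableEq ι] (s : Finset ι) (f : ι → (Fin n → Bool) → Bool)
    (hf : ∀ i ∈ s, HasDegF p (f i) d) :
    HasDegF p (fun x => decide ((s.filter fun i => f i x = true).card % 2 = 1)) (s.card * d) := by
  induction s using Finset.induction_on with
  | empty =>
    simp only [Finset.filter_empty, Finset.card_empty, Nat.zero_mod, zero_ne_one, decide_false, zero_mul]
    exact RigidityLaws.hasDegF_const p false 0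
  | insert a s ha ih =>
    have hfa : HasDegF p (f a) d := hf a (Finset.mem_insert_self a s)
    have ih' := ih fun i hi => hf i (Finset.mem_insert_of_mem hi)
    have key : (fun x => decide (((insert a s).filter fun i => f i x = true).card % 2 = 1)) =
        fun x => Bool.xor (f a x) (decide ((s.filter fun i => f i x = true).card % 2 = 1)) := by
      funext x
      rw [Finset.filter_insert]
      cases hx : f a x
      · simp
      · rw [if_pos rfl, Finset.card_insert_of_notMem (fun h => ha (Finset.mem_filter.mp h).1), decide_succ_odd]
        simp
    rw [key, Finset.card_insert_of_notMem ha, Nat.succ_mul, Nat.add_comm]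
    exact RigidityLaws.hasDegF_xor hfa ih'

/-! ## §3 THE ABSORBING PAIR: an even eliminator triple is two walk slots -/

variable {ℓ : ℕ}

/-- the first window bit (`false` on the empty window). -/
def bit0 (w : Fin ℓ → Bool) : Bool := if h : 0 < ℓ then w ⟨0, h⟩ else false

/-- **the absorbing pair** of an eliminator triple `P` (consulted at `|w| mod 3`, charge `c`): fire
`E₂ ⊕ (E₀ ∧ w₀)` at walk slot `0` and `E₀` at walk slot `1`, nothing elsewhere, where `E_x := P_{(x - c) mod 3}` is the
triple re-indexed by the residue `x` of the slot-0 position `c + |w|` (`E₀ = P_{2c mod 3}`, `E₂ = P_{(2 + 2c) mod 3}`). -/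
def absorb (c : ℕ) (P : ℕ → (Fin ℓ → Bool) → Bool) : Fin (ℓ + 1) → (Fin ℓ → Bool) → Bool :=
  fun g w =>
    if g.val = 0 then Bool.xor (P ((2 + 2 * c) % 3) w) (P ((2 * c) % 3) w && bit0 w)
    else if g.val = 1 then P ((2 * c) % 3) w else false

/-- `W_1(w) = [w₀]` for `ℓ ≥ 1`. -/
private theorem wtPrefix_one (hℓ : 0 < ℓ) (w : Fin ℓ → Bool) :
    wtPrefix w 1 = if w ⟨0, hℓ⟩ = true then 1 else 0 := by
  unfold wtPrefix
  have e : (univ.filter fun i : Fin ℓ => i.val < 1 ∧ w i = true) =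
      if w ⟨0, hℓ⟩ = true then {⟨0, hℓ⟩} else ∅ := by
    ext i
    simp only [Finset.mem_filter, Finset.mem_univ, true_and, Nat.lt_one_iff]
    constructor
    · rintro ⟨hi, hwi⟩
      have : i = ⟨0, hℓ⟩ := Fin.ext hi
      subst this
      rw [if_pos hwi]; exact Finset.mem_singleton_self _
    · intro hi
      split_ifs at hi with h
      · rw [Finset.mem_singleton] at hi; subst hi; exact ⟨rfl, h⟩
      · exact absurd hi (Finset.notMem_empty _)
  rw [e]; split_ifs <;> simp

/-- the triple read through a case table. -/
private def tri (P0 P1 P2 : Bool) (i : ℕ) : Bool := if i = 0 then P0 else if i = 1 then P1 else P2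

/-- AbsorptionDialA helper `tri_eq` (decomp-qadv land package; see the module docstring). -/
private theorem tri_eq (P : ℕ → (Fin ℓ → Bool) → Bool) (w : Fin ℓ → Bool) {i : ℕ} (hi : i < 3) :
    P i w = tri (P 0 w) (P 1 w) (P 2 w) i := by
  interval_cases i <;> simp [tri]

/-- the finite heart of the gadget: for every charge residue, weight residue, first bit and even triple, the two
absorbing slots reproduce the triple's bit. -/
private theorem absorb_table :
    ∀ (cm r : ℕ), cm < 3 → r < 3 → ∀ (b P0 P1 P2 : Bool), Bool.xor P0 (Bool.xor P1 P2) = false →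
      decide (((if (Bool.xor (tri P0 P1 P2 ((2 + 2 * cm) % 3)) (tri P0 P1 P2 ((2 * cm) % 3) && b) = true ∧
                  (cm + r) % 3 ≠ 0) then 1 else 0) +
               (if (tri P0 P1 P2 ((2 * cm) % 3) = true ∧ (cm + 1 + r + (if b = true then 1 else 0)) % 3 ≠ 0)
                  then 1 else 0)) % 2 = 1) = tri P0 P1 P2 r := by
  intro cm r hcm hr
  interval_cases cm <;> interval_cases r <;> decide

/-- **ABSORPTION IDENTITY.**  For `ℓ ≥ 1` and an EVEN triple `P` (`P₀ ⊕ P₁ ⊕ P₂ ≡ 0`), the absorbing pair wins exactly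
where the triple's bit `P_{|w| mod 3}(w)` is `1`. -/
theorem ringWinU_absorb (hℓ : 1 ≤ ℓ) (c : ℕ) (P : ℕ → (Fin ℓ → Bool) → Bool)
    (hP : ∀ w, Bool.xor (P 0 w) (Bool.xor (P 1 w) (P 2 w)) = false) (w : Fin ℓ → Bool) :
    ringWinU c (absorb c P) w = P (wt w % 3) w := by
  classical
  obtain ⟨ℓ', rfl⟩ : ∃ ℓ', ℓ = ℓ' + 1 := ⟨ℓ - 1, by omega⟩
  have h0 : (0 : ℕ) < ℓ' + 1 := by omega
  unfold ringWinU
  rw [Finset.card_filter, Fin.sum_univ_succ, Fin.sum_univ_succ]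
  have hrest : ∑ i : Fin ℓ', (if absorb c P i.succ.succ w = true ∧
      (c + (i.succ.succ : Fin (ℓ' + 1 + 1)).val + walkExp w (i.succ.succ : Fin (ℓ' + 1 + 1)).val) % 3 ≠ 0
      then 1 else 0) = 0 := by
    refine Finset.sum_eq_zero fun i _ => ?_
    have : absorb c P i.succ.succ w = false := by
      unfold absorb; simp [Fin.val_succ]
    simp [this]
  rw [hrest, add_zero]
  have hb : bit0 w = w ⟨0, h0⟩ := by unfold bit0; rw [dif_pos h0]
  have hslot0 : absorb c P (0 : Fin (ℓ' + 1 + 1)) w =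
      Bool.xor (P ((2 + 2 * c) % 3) w) (P ((2 * c) % 3) w && w ⟨0, h0⟩) := by
    unfold absorb; simp [hb]
  have hslot1 : absorb c P ((0 : Fin (ℓ' + 1)).succ) w = P ((2 * c) % 3) w := by
    unfold absorb; simp
  have hv0 : ((0 : Fin (ℓ' + 1 + 1)).val) = 0 := rfl
  have hv1 : (((0 : Fin (ℓ' + 1)).succ : Fin (ℓ' + 1 + 1)).val) = 1 := rfl
  rw [hslot0, hslot1, hv0, hv1, RigidityLaws.walkExp_zero]
  have hw1 : walkExp w 1 = wt w + (if w ⟨0, h0⟩ = true then 1 else 0) := by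
    unfold walkExp; rw [wtPrefix_one h0]
  rw [hw1]
  -- reduce every residue to `cm := c % 3` and `r := wt w % 3`
  have hcm : c % 3 < 3 := Nat.mod_lt _ (by norm_num)
  have hr : wt w % 3 < 3 := Nat.mod_lt _ (by norm_num)
  have e1 : (2 + 2 * c) % 3 = (2 + 2 * (c % 3)) % 3 := by omega
  have e2 : (2 * c) % 3 = (2 * (c % 3)) % 3 := by omega
  have e3 : (c + 0 + wt w) % 3 = (c % 3 + wt w % 3) % 3 := by omega
  have e4 : (c + 1 + (wt w + (if w ⟨0, h0⟩ = true then 1 else 0))) % 3 =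
      (c % 3 + 1 + wt w % 3 + (if w ⟨0, h0⟩ = true then 1 else 0)) % 3 := by
    split_ifs <;> omega
  rw [e1, e2, e3, e4]
  rw [tri_eq P w (i := (2 + 2 * (c % 3)) % 3) (Nat.mod_lt _ (by norm_num)),
    tri_eq P w (i := (2 * (c % 3)) % 3) (Nat.mod_lt _ (by norm_num)),
    tri_eq P w (i := wt w % 3) hr]
  exact absorb_table (c % 3) (wt w % 3) hcm hr (w ⟨0, h0⟩) (P 0 w) (P 1 w) (P 2 w) (hP w)

/-- **mixed = plain**: a walk strategy assisted by an even eliminator triple (the tree's MIXED GAME,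
`WindowLocalization.mixedWinU`) is the PLAIN walk game of the strategy XOR the absorbing pair. -/
theorem mixedWinU_eq_ringWinU_absorb (hℓ : 1 ≤ ℓ) (c : ℕ) (P : ℕ → (Fin ℓ → Bool) → Bool)
    (hP : ∀ w, Bool.xor (P 0 w) (Bool.xor (P 1 w) (P 2 w)) = false)
    (y : Fin (ℓ + 1) → (Fin ℓ → Bool) → Bool) (w : Fin ℓ → Bool) :
    mixedWinU c P y w = ringWinU c (RegisterRotation.xorStrat y (absorb c P)) w := by
  rw [RegisterRotation.ringWinU_xorStrat, ringWinU_absorb hℓ c P hP, mixedWinU, Bool.xor_comm]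

/-- degree of the absorbing pair: `≤ 2D + 1` when the triple has degree `≤ D`. -/
theorem hasDegF_absorb {D : ℕ} (c : ℕ) (P : ℕ → (Fin ℓ → Bool) → Bool) (hP : ∀ r, HasDegF p (P r) D)
    (g : Fin (ℓ + 1)) : HasDegF p (absorb c P g) (2 * D + 1) := by
  have hbit : HasDegF p (bit0 : (Fin ℓ → Bool) → Bool) 1 := by
    unfold bit0
    split_ifs with h
    · simpa using hasDegF_of_junta (p := p) ({⟨0, h⟩} : Finset (Fin ℓ)) (fun w : Fin ℓ → Bool => w ⟨0, h⟩)
        (fun u v huv => huv ⟨0, h⟩ (Finset.mem_singleton_self _))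
    · exact RigidityLaws.hasDegF_const p false 1
  by_cases h0 : g.val = 0
  · have : absorb c P g = fun w => Bool.xor (P ((2 + 2 * c) % 3) w) (P ((2 * c) % 3) w && bit0 w) := by
      funext w; unfold absorb; rw [if_pos h0]
    rw [this]
    have h := RigidityLaws.hasDegF_xor (hP ((2 + 2 * c) % 3)) (RegisterRotation.hasDegF_and (hP ((2 * c) % 3)) hbit)
    exact (show D + (D + 1) = 2 * D + 1 by ring) ▸ h
  · by_cases h1 : g.val = 1
    · have : absorb c P g = P ((2 * c) % 3) := by
        funext w; unfold absorb; rw [if_neg h0, if_pos h1]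
      rw [this]
      unfold HasDegF
      exact lowDeg_mono (by omega) (hP _)
    · have : absorb c P g = fun _ => false := by
        funext w; unfold absorb; rw [if_neg h0, if_neg h1]
      rw [this]; exact RigidityLaws.hasDegF_const p false _

/-! ## §4 WINDOW ABSORPTION: the walk game on a window fibre is the PLAIN walk game on the window -/

section Window

variable {k ℓ q : ℕ} (c : ℕ) (y : Fin (k + ℓ + q + 1) → (Fin (k + ℓ + q) → Bool) → Bool)

/-- every coordinate of `w ↦ a ++ w ++ b` is a constant or a window variable. -/
theorem glue3_subst (a : Fin k → Bool) (b : Fin q → Bool) : ∀ i : Fin (k + ℓ + q),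
    (∃ bb, ∀ w : Fin ℓ → Bool, glue3 a w b i = bb) ∨ (∃ j, ∀ w : Fin ℓ → Bool, glue3 a w b i = w j) := by
  intro i
  induction i using Fin.addCases with
  | left i' =>
    induction i' using Fin.addCases with
    | left j => exact Or.inl ⟨a j, fun w => by unfold glue3; rw [Fin.append_left, Fin.append_left]⟩
    | right j => exact Or.inr ⟨j, fun w => by unfold glue3; rw [Fin.append_left, Fin.append_right]⟩
  | right j => exact Or.inl ⟨b j, fun w => by unfold glue3; rw [Fin.append_right]⟩

/-- restriction to a window fibre keeps the `𝔽_p`-degree (`Smolensky.comp_subst_mem_lowDeg`). -/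
theorem hasDegF_glue3 {d : ℕ} {f : (Fin (k + ℓ + q) → Bool) → Bool} (hf : HasDegF p f d)
    (a : Fin k → Bool) (b : Fin q → Bool) : HasDegF p (fun w : Fin ℓ → Bool => f (glue3 a w b)) d := by
  unfold HasDegF at *
  exact comp_subst_mem_lowDeg (fun w => glue3 a w b) (glue3_subst a b) hf

/-- the window strategy keeps the degree. -/
theorem hasDegF_inStrategy {d : ℕ} (hy : ∀ g, HasDegF p (y g) d) (a : Fin k → Bool) (b : Fin q → Bool)
    (g' : Fin (ℓ + 1)) : HasDegF p (inStrategy y a b g') d := by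
  unfold inStrategy
  exact hasDegF_glue3 (hy _) a b

/-- the outside positions: `g < k` or `g > k + ℓ`; there are `k + q` of them. -/
theorem card_outside (k ℓ q : ℕ) :
    (univ.filter fun g : Fin (k + ℓ + q + 1) => g.val < k ∨ k + ℓ < g.val).card = k + q := by
  rw [Finset.filter_or, Finset.card_union_of_disjoint
    (Finset.disjoint_filter.mpr fun g _ (h1 : g.val < k) (h2 : k + ℓ < g.val) => by omega)]
  have h1 : (univ.filter fun g : Fin (k + ℓ + q + 1) => g.val < k).card = k := by
    rw [Fin.card_filter_val_lt, min_eq_right (by omega)]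
  have h2 : (univ.filter fun g : Fin (k + ℓ + q + 1) => k + ℓ < g.val).card = q := by
    have e : (univ.filter fun g : Fin (k + ℓ + q + 1) => k + ℓ < g.val) =
        univ.filter fun g : Fin (k + ℓ + q + 1) => ¬ (g.val < k + ℓ + 1) :=
      Finset.filter_congr fun g _ => by omega
    have h3 := Finset.card_filter_add_card_filter_not
      (s := (univ : Finset (Fin (k + ℓ + q + 1)))) (fun g : Fin (k + ℓ + q + 1) => g.val < k + ℓ + 1)
    rw [Fin.card_filter_val_lt, min_eq_right (by omega), Finset.card_univ, Fintype.card_fin] at h3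
    rw [e]; omega
  rw [h1, h2]

/-- the outside triple as the parity of a family of (constant ∧ restricted selector)'s over the outside positions. -/
theorem outParity_eq (a : Fin k → Bool) (b : Fin q → Bool) (r : ℕ) :
    outParity y c a b r = fun w => decide ((((univ : Finset (Fin (k + ℓ + q + 1))).filter
      fun g => g.val < k ∨ k + ℓ < g.val).filter fun g =>
        (decide (gapChar ℓ c a b g.val r % 3 ≠ 0) && y g (glue3 a w b)) = true).card % 2 = 1) := by
  funext w
  have e : ((univ : Finset (Fin (k + ℓ + q + 1))).filter fun g =>
        (g.val < k ∨ k + ℓ < g.val) ∧ y g (glue3 a w b) = true ∧ gapChar ℓ c a b g.val r % 3 ≠ 0) =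
      (((univ : Finset (Fin (k + ℓ + q + 1))).filter fun g => g.val < k ∨ k + ℓ < g.val).filter fun g =>
        (decide (gapChar ℓ c a b g.val r % 3 ≠ 0) && y g (glue3 a w b)) = true) := by
    rw [Finset.filter_filter]
    refine Finset.filter_congr fun g _ => ?_
    rw [Bool.and_eq_true, decide_eq_true_iff]
    tauto
  unfold outParity outCount
  rw [e]

/-- **the outside triple has `𝔽_p`-degree `≤ (k + q)·d`** — at `p ≥ 5` the XOR of the `k + q` restricted outside
selectors COSTS (contrast the tree's `hasDeg_outParity` at `p = 2`, where it is free). -/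
theorem hasDegF_outParity {d : ℕ} (hy : ∀ g, HasDegF p (y g) d) (a : Fin k → Bool) (b : Fin q → Bool)
    (r : ℕ) : HasDegF p (outParity y c a b r) ((k + q) * d) := by
  have hfam : ∀ g ∈ ((univ : Finset (Fin (k + ℓ + q + 1))).filter fun g => g.val < k ∨ k + ℓ < g.val),
      HasDegF p ((fun (g : Fin (k + ℓ + q + 1)) (w : Fin ℓ → Bool) =>
        decide (gapChar ℓ c a b g.val r % 3 ≠ 0) && y g (glue3 a w b)) g) d := by
    intro g _
    have h := RegisterRotation.hasDegF_and
      (RigidityLaws.hasDegF_const p (decide (gapChar ℓ c a b g.val r % 3 ≠ 0)) 0) (hasDegF_glue3 (hy g) a b)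
    rw [Nat.zero_add] at h
    exact h
  have h := hasDegF_parity _ _ hfam
  rw [card_outside] at h
  rw [outParity_eq]
  exact h

/-- **the absorbed window strategy**: the window strategy XOR the absorbing pair of the outside triple. -/
def windowAbsorb (a : Fin k → Bool) (b : Fin q → Bool) : Fin (ℓ + 1) → (Fin ℓ → Bool) → Bool :=
  RegisterRotation.xorStrat (inStrategy y a b) (absorb (inCharge c a b) (outParity y c a b))

/-- **WINDOW ABSORPTION IDENTITY** (`ℓ ≥ 1`): on the fibre `a ++ w ++ b` the big strategy wins iff the absorbed window
strategy wins the PLAIN walk game on `w` at the window charge `c' = c + k + 2|a| + |b|`. -/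
theorem ringWinU_glue3_eq_windowAbsorb (hℓ : 1 ≤ ℓ) (a : Fin k → Bool) (b : Fin q → Bool)
    (w : Fin ℓ → Bool) :
    ringWinU c y (glue3 a w b) = ringWinU (inCharge c a b) (windowAbsorb c y a b) w := by
  rw [ringWinU_glue3_eq_mixedWinU c y a w b]
  exact mixedWinU_eq_ringWinU_absorb hℓ _ _ (fun w' => outParity_even c y a b w') _ w

/-- **degree of the absorbed window strategy**: `≤ d + 2(k+q)d + 1` — every frozen outside position costs `2d`. -/
theorem hasDegF_windowAbsorb {d : ℕ} (hy : ∀ g, HasDegF p (y g) d) (a : Fin k → Bool) (b : Fin q → Bool)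
    (g : Fin (ℓ + 1)) : HasDegF p (windowAbsorb c y a b g) (d + (2 * ((k + q) * d) + 1)) :=
  RegisterRotation.hasDegF_xorStrat (hasDegF_inStrategy y hy a b)
    (hasDegF_absorb (inCharge c a b) (outParity y c a b) (hasDegF_outParity c y hy a b)) g

/-! ## §5 THE LENS LAW: a strategy with fewer than `2^(k+q)` losses IS a perfect plain strategy on a window -/

/-- AbsorptionDialA helper `glue3_prefix` (decomp-qadv land package; see the module docstring). -/
theorem glue3_prefix (a : Fin k → Bool) (w : Fin ℓ → Bool) (b : Fin q → Bool) (i : Fin k) :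
    glue3 a w b (Fin.castAdd q (Fin.castAdd ℓ i)) = a i := by
  unfold glue3; rw [Fin.append_left, Fin.append_left]

/-- AbsorptionDialA helper `glue3_suffix` (decomp-qadv land package; see the module docstring). -/
theorem glue3_suffix (a : Fin k → Bool) (w : Fin ℓ → Bool) (b : Fin q → Bool) (j : Fin q) :
    glue3 a w b (Fin.natAdd (k + ℓ) j) = b j := by
  unfold glue3; rw [Fin.append_right]

/-- pigeonhole: one loser in every window fibre ⟹ at least `2^k·2^q` losers. -/
theorem card_losers_ge_of_windows (h : ∀ (a : Fin k → Bool) (b : Fin q → Bool), ∃ w : Fin ℓ → Bool,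
      ringWinU c y (glue3 a w b) = false) :
    2 ^ k * 2 ^ q ≤ (univ.filter fun u : Fin (k + ℓ + q) → Bool => ringWinU c y u = false).card := by
  classical
  choose w hw using h
  have hinj : Function.Injective
      fun ab : (Fin k → Bool) × (Fin q → Bool) => glue3 ab.1 (w ab.1 ab.2) ab.2 := by
    rintro ⟨a, b⟩ ⟨a', b'⟩ hab
    have hab' : glue3 a (w a b) b = glue3 a' (w a' b') b' := hab
    have ha : a = a' := by
      funext i
      have := congrFun hab' (Fin.castAdd q (Fin.castAdd ℓ i))
      rwa [glue3_prefix, glue3_prefix] at this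
    have hb : b = b' := by
      funext j
      have := congrFun hab' (Fin.natAdd (k + ℓ) j)
      rwa [glue3_suffix, glue3_suffix] at this
    rw [ha, hb]
  calc 2 ^ k * 2 ^ q = (univ : Finset ((Fin k → Bool) × (Fin q → Bool))).card := by
        rw [Finset.card_univ, Fintype.card_prod, Fintype.card_fun, Fintype.card_fun, Fintype.card_bool,
          Fintype.card_fin, Fintype.card_fin]
    _ = ((univ : Finset ((Fin k → Bool) × (Fin q → Bool))).image
          fun ab => glue3 ab.1 (w ab.1 ab.2) ab.2).card := (Finset.card_image_of_injective _ hinj).symm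
    _ ≤ (univ.filter fun u : Fin (k + ℓ + q) → Bool => ringWinU c y u = false).card := by
        apply Finset.card_le_card
        intro u hu
        rw [Finset.mem_image] at hu
        obtain ⟨⟨a, b⟩, -, rfl⟩ := hu
        rw [Finset.mem_filter]
        exact ⟨mem_univ _, hw a b⟩

/-- fewer than `2^k·2^q` losers ⟹ some window fibre carries NO loss. -/
theorem exists_perfect_fibre
    (h : (univ.filter fun u : Fin (k + ℓ + q) → Bool => ringWinU c y u = false).card < 2 ^ k * 2 ^ q) :
    ∃ (a : Fin k → Bool) (b : Fin q → Bool), ∀ w : Fin ℓ → Bool, ringWinU c y (glue3 a w b) = true := by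
  by_contra hno
  simp only [not_exists, not_forall, Bool.not_eq_true] at hno
  exact absurd (card_losers_ge_of_windows c y hno) (not_le.mpr h)

/-- **THE LENS LAW (near-perfect IS perfect).**  A strategy of cut degree `≤ d` on `k + ℓ + q` bits (`ℓ ≥ 1`) that loses
on fewer than `2^k·2^q` inputs yields a PERFECT strategy of the PLAIN walk game on `ℓ` bits (some charge) with cut degree
`≤ d + 2(k+q)d + 1`: a minimal counterexample to «many losses» is a counterexample to «one loss». -/
theorem perfect_of_few_losses (hℓ : 1 ≤ ℓ) {d : ℕ} (hy : ∀ g, HasDegF p (y g) d)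
    (h : (univ.filter fun u : Fin (k + ℓ + q) → Bool => ringWinU c y u = false).card < 2 ^ k * 2 ^ q) :
    ∃ c' : ℕ, ∃ y' : Fin (ℓ + 1) → (Fin ℓ → Bool) → Bool,
      (∀ g, HasDegF p (y' g) (d + (2 * ((k + q) * d) + 1))) ∧ ∀ w, ringWinU c' y' w = true := by
  obtain ⟨a, b, hab⟩ := exists_perfect_fibre c y h
  exact ⟨inCharge c a b, windowAbsorb c y a b, hasDegF_windowAbsorb c y hy a b, fun w => by
    rw [← ringWinU_glue3_eq_windowAbsorb c y hℓ a b w]; exact hab w⟩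

end Window

end Summit.QuantumAdvantage.QuantumAdvantage.Theorems.AbsorptionDial
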